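import Summits.AtomisticToContinuum.Crystallization.Theorems.ChargedEnergyGapChartDialV
import Summits.AtomisticToContinuum.Crystallization.Theorems.ChargedEnergyGapChartDialX
import Summits.AtomisticToContinuum.Crystallization.Theorems.ChargedEnergyGapChartDialZ
import Summits.AtomisticToContinuum.Crystallization.Theorems.ChargedEnergyGapChartDialZA
import Summits.AtomisticToContinuum.Crystallization.Theorems.ChargedEnergyGapChartDialR
import Literature.Geometry.DiscreteGeometry.ShellCensusTwelve

/-!
# `ChargedEnergyGap` · the CHART DIAL, part ZB: THE CENSUS FACTS OF A SCALE-FREE DOZEN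
(decomp-a2c lens-3 g39 node «ChargeFreeGap»; ninth input of the [G] port plan — everything the abstract census frame
`Literature…ShellCensusSearch.CF` asks of `(bond, tri)`, proved for the labelled fan of a scale-free dozen)

For a scale-free dozen `IsScaleFreeDozen t B` (part Q) with normalised code `u`, fan triples `tri`, fan angles `ang` (as in
parts Z / ZA) and any Boolean table `bond` of `B`, `IsScaleFreeDozen.censusFacts` delivers the TWELVE FIELDS of the census
frame verbatim: `bond` symmetric, irreflexive, four per label; triples are 3-sets, twenty of them, two per side; bonds are
sides; bonded triangles are triples; links are connected; and NO `4T` / `3T+Q` / `3T+2H` star — the last three by part V's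
parametric kills at `(tmax, qmax, hmax) = (t₀, 2t₀, t₀)`, `t₀ = arccos (31/100)`, fed by part ZA's corner bounds and
`budgets_of_five_lt five_arccos_lt_two_pi`; the structural fields by parts W (dictionary), X (origin interior), Z (fan
struct).  §3 is the metric half of the pattern dictionary: `dist (fccTuple v) (fccTuple w) = 1 ↔ sqNormInt (fccVec v - fccVec w) = 2`
and the hcp analogue (`18`), from part R's `dist_eq_one_iff_sqNormInt`.

What remains for [G] `DozenBondGraphs fccTuple hcpTuple` is ONLY the call of the tree's census theorem
`ShellCensusSearch.CF.concl` on the frame built from these facts and the `patAdj0/1/2_iff` dictionary (part ZC; the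
`ShellCensusSearch*` modules are not built in the farm snapshot this node is checked against).
No `sorry`, no new axiom, no instance / notation / option; no new definitions.
-/

noncomputable section

open scoped RealInnerProductSpace
open Literature.MathematicalPhysics.StatisticalMechanics
open Literature.Geometry.DiscreteGeometry
open Literature.Geometry.DiscreteGeometry.ShellCensus
open Summit.AtomisticToContinuum.Crystallization.Theses.PricedLinkCensus
open Summit.AtomisticToContinuum.Crystallization.Theorems.ChargedEnergyGapNegative

namespace Summit.AtomisticToContinuum.Crystallization.Theorems.ChargedEnergyGapChartDial

/-! ## §1 The fan angles, equation form -/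

/-- Part ZA's `IsScaleFreeDozen.fanAngles` with the abbreviations as explicit arguments. -/
theorem IsScaleFreeDozen.fanAngles_eq {t : Fin 12 → E3} {B : Fin 12 → Fin 12 → Prop} (hD : IsScaleFreeDozen t B)
    (h0 : (0 : E3) ∈ interior (convexHull ℝ (Set.range fun k => ‖t k‖⁻¹ • t k)))
    (u : Fin 12 → E3) (hu : u = fun k => ‖t k‖⁻¹ • t k) (X : Finset E3) (hX : X = Finset.univ.image u)
    (tri : Finset (Finset (Fin 12))) (htri : tri = Finset.univ.powerset.filter fun S => S.image u ∈ fanTriSets X)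
    (ang : Finset (Fin 12) → Fin 12 → ℝ) (hang : ang = fun S k => triAngleAt X (S.image u) (u k)) :
    (∀ S v, 0 ≤ ang S v) ∧ (∀ S v, v ∉ S → ang S v = 0) ∧ (∀ v, ∑ S ∈ tri, ang S v = 2 * Real.pi) ∧
      (∀ S ∈ tri, (∀ v ∈ S, ∀ w ∈ S, v ≠ w → B v w) → ∀ v ∈ S, ang S v ≤ Real.arccos (31 / 100)) ∧
      (∀ v a x, ({v, a, x} : Finset (Fin 12)) ∈ tri → B v a → B a x → v ≠ x →
        ang {v, a, x} v ≤ Real.arccos (31 / 100)) ∧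
      (∀ v d a x, ({v, d, a} : Finset (Fin 12)) ∈ tri → B v d → B v a → B d x → B x a → v ≠ x →
        ang {v, d, a} v ≤ 2 * Real.arccos (31 / 100)) := by
  subst hang htri hX hu
  exact hD.fanAngles h0

/-! ## §2 The twelve census fields -/

/-- **The census facts of a scale-free dozen**: for its normalised code `u`, fan triples `tri`, fan angles `ang` and a
Boolean table `bond` of the bond relation `B`, the twelve fields of the tree's abstract census frame
`ShellCensusSearch.CF`, verbatim. -/
theorem IsScaleFreeDozen.censusFacts {t : Fin 12 → E3} {B : Fin 12 → Fin 12 → Prop} (hD : IsScaleFreeDozen t B)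
    (u : Fin 12 → E3) (hu : u = fun k => ‖t k‖⁻¹ • t k) (X : Finset E3) (hX : X = Finset.univ.image u)
    (tri : Finset (Finset (Fin 12))) (htri : tri = Finset.univ.powerset.filter fun S => S.image u ∈ fanTriSets X)
    (ang : Finset (Fin 12) → Fin 12 → ℝ) (hang : ang = fun S k => triAngleAt X (S.image u) (u k))
    (bond : Fin 12 → Fin 12 → Bool) (hbond : ∀ v w, bond v w = true ↔ B v w) :
    (∀ v w, bond v w = bond w v) ∧ (∀ v, bond v v = false) ∧
      (∀ v, (Finset.univ.filter fun w => bond v w = true).card = 4) ∧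
      (∀ S ∈ tri, S.card = 3) ∧ tri.card = 20 ∧
      (∀ S ∈ tri, ∀ s ⊆ S, s.card = 2 → (tri.filter fun S' => s ⊆ S').card = 2) ∧
      (∀ v w, bond v w = true → (tri.filter fun S' => ({v, w} : Finset (Fin 12)) ⊆ S').card = 2) ∧
      (∀ a b c, a ≠ b → b ≠ c → a ≠ c → bond a b = true → bond b c = true → bond a c = true →
        ({a, b, c} : Finset (Fin 12)) ∈ tri) ∧
      (∀ v, ∀ A ⊆ tri.filter (fun S => v ∈ S), A.Nonempty →
        (∀ S ∈ A, ∀ S' ∈ tri, v ∈ S' → (S ∩ S').card = 2 → S' ∈ A) → A = tri.filter fun S => v ∈ S) ∧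
      (∀ v a b c d : Fin 12,
        (tri.filter fun S => v ∈ S) = {{v, a, b}, {v, b, c}, {v, c, d}, {v, d, a}} →
        bond v a = true → bond v b = true → bond v c = true → bond v d = true →
        bond a b = true → bond b c = true → bond c d = true → bond d a = true → False) ∧
      (∀ v a b c d x : Fin 12,
        (tri.filter fun S => v ∈ S) = {{v, a, b}, {v, b, c}, {v, c, d}, {v, d, a}} →
        bond v a = true → bond v b = true → bond v c = true → bond v d = true →
        bond a b = true → bond b c = true → bond c d = true → bond d a = false → d ≠ a →
        bond d x = true → bond x a = true → bond v x = false → x ≠ v → False) ∧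
      (∀ v a b c d x : Fin 12,
        (tri.filter fun S => v ∈ S) = {{v, a, b}, {v, b, c}, {v, c, d}, {v, d, x}, {v, a, x}} →
        bond v a = true → bond v b = true → bond v c = true → bond v d = true →
        bond a b = true → bond b c = true → bond c d = true → bond d x = true → bond a x = true →
        bond v x = false → v ≠ x → False) := by
  classical
  -- the dictionary (part W) and the origin (part X)
  have hu1 : ∀ k, ‖u k‖ = 1 := by subst hu; exact hD.norm_normalize
  have hinj : Function.Injective u := by subst hu; exact hD.normalize_injective
  have hhi : ∀ k l, k ≠ l → ⟪u k, u l⟫ ≤ 2801 / 5202 := by subst hu; exact fun k l => hD.inner_normalize_le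
  have hlo : ∀ k l, B k l → 2201 / 4802 ≤ ⟪u k, u l⟫ := by subst hu; exact fun k l => hD.le_inner_normalize
  have h0u : (0 : E3) ∈ interior (convexHull ℝ (Set.range u)) :=
    originInterior_of_code u hu1 B hhi hlo fun k => by subst hu; exact hD.card_filter_ne_bond k
  have h0 : (0 : E3) ∈ interior (convexHull ℝ (Set.range fun k => ‖t k‖⁻¹ • t k)) := hu ▸ h0u
  -- the fan structure (part Z) and the fan angles (part ZA)
  obtain ⟨F1, F2, F3, F4, F5, F6⟩ := fanStruct_of_code_eq u hu1 hinj B hhi hlo h0u X hX tri htri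
  obtain ⟨A1, A2, A3, A4, A5, A6⟩ := hD.fanAngles_eq h0 u hu X hX tri htri ang hang
  -- the angle budget (parts U, V)
  obtain ⟨b4, b5⟩ := budgets_of_five_lt (Real.arccos_nonneg (31 / 100)) five_arccos_lt_two_pi
  -- Boolean ↔ propositional bonds
  have hb : ∀ {v w}, bond v w = true → B v w := fun h => (hbond _ _).1 h
  have hsymm : ∀ v w, bond v w = bond w v := fun v w => by
    rw [Bool.eq_iff_iff, hbond, hbond]
    exact ⟨fun h => hD.symm h, fun h => hD.symm h⟩
  have tC : ∀ S ∈ tri, (∀ v ∈ S, ∀ w ∈ S, v ≠ w → bond v w = true) → ∀ v ∈ S,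
      ang S v ≤ Real.arccos (31 / 100) :=
    fun S hS hbS v hv => A4 S hS (fun v hv w hw hvw => hb (hbS v hv w hw hvw)) v hv
  have hC : ∀ v a x, ({v, a, x} : Finset (Fin 12)) ∈ tri → bond v a = true → bond a x = true →
      bond v x = false → v ≠ x → ang {v, a, x} v ≤ Real.arccos (31 / 100) :=
    fun v a x hS hva hax _ hvx => A5 v a x hS (hb hva) (hb hax) hvx
  have qC : ∀ v d a x, ({v, d, a} : Finset (Fin 12)) ∈ tri → bond v d = true → bond v a = true →
      bond d a = false → d ≠ a → bond d x = true → bond x a = true → bond v x = false → x ≠ v →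
      ang {v, d, a} v ≤ 2 * Real.arccos (31 / 100) :=
    fun v d a x hS hvd hva _ _ hdx hxa _ hxv => A6 v d a x hS (hb hvd) (hb hva) (hb hdx) (hb hxa) hxv.symm
  refine ⟨hsymm, ?_, ?_, F1, F2, F3, fun v w h => F4 v w (hD.ne_of_bond (hb h)) (hb h),
    fun a b c hab hbc hac kab kbc kac => F5 a b c hab hbc hac (hb kab) (hb kbc) (hb kac), F6, ?_, ?_, ?_⟩
  · -- irreflexive
    intro v
    cases h : bond v v
    · rfl
    · exact absurd (hb h) (hD.irrefl v)
  · -- four bonds per label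
    intro v
    rw [← hD.card_filter_bond v]
    congr 1
    ext w
    simp only [Finset.mem_filter, Finset.mem_univ, true_and]
    exact hbond v w
  · -- no `4T` star
    intro v a b c d hstar hva hvb hvc hvd hab hbc hcd hda
    exact kill4T_of_budget bond tri ang hsymm A1 A2 A3 tC b4 v a b c d hstar hva hvb hvc hvd hab hbc hcd hda
  · -- no `3T+Q` star
    intro v a b c d x hstar hva hvb hvc hvd hab hbc hcd hda hda' hdx hxa hvx hxv
    exact kill3TQ_of_budget bond tri ang hsymm A1 A2 A3 tC qC b5 v a b c d x hstar hva hvb hvc hvd hab hbc hcd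
      hda hda' hdx hxa hvx hxv
  · -- no `3T+2H` star
    intro v a b c d x hstar hva hvb hvc hvd hab hbc hcd hdx hax hvx hvx'
    exact kill3T2H_of_budget bond tri ang hsymm A1 A2 A3 tC hC b5 v a b c d x hstar hva hvb hvc hvd hab hbc hcd
      hdx hax hvx hvx'

/-! ## §3 The metric half of the pattern dictionary -/

/-- Unit distances of `fccTuple` are squared integer distances `2` of `fccVec`. -/
theorem dist_fccTuple_eq_one_iff (v w : Fin 12) :
    dist (fccTuple v) (fccTuple w) = 1 ↔ sqNormInt (fccVec v - fccVec w) = ((2 : ℕ) : ℤ) :=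
  dist_eq_one_iff_sqNormInt (N := 2) two_ne_zero (fccVec v) (fccVec w)

/-- Unit distances of `hcpTuple` are squared integer distances `18` of `hcpVec`. -/
theorem dist_hcpTuple_eq_one_iff (v w : Fin 12) :
    dist (hcpTuple v) (hcpTuple w) = 1 ↔ sqNormInt (hcpVec v - hcpVec w) = ((18 : ℕ) : ℤ) :=
  dist_eq_one_iff_sqNormInt (N := 18) (by norm_num) (hcpVec v) (hcpVec w)

end Summit.AtomisticToContinuum.Crystallization.Theorems.ChargedEnergyGapChartDial

end
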